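import Literature.NumberTheory.EllipticCurves.PeriodLatticePresentationProofs
import Summits.BirchSwinnertonDyer.BirchSwinnertonDyer.Theorems.EisensteinDepletionAtTwoStarOptBNSFX1RatPres
import HarnessLib

/-!
# The `c`-division witness, nodes N1–N3 + N5: integer `x`-presentation, pole killing, invariant extension, stabiliser

Cell `bsd-f2-manin`, prover seat p2 (gen 20); crux C2 `ManinOddAtFour` (stmt-BirchSwinnertonDyer-22967), also C3
`ManinPrimeToThreeAtNine` (stmt-22968); line of record `halving_udc` / an g44's `c`-DIVISION WITNESS
`F = 12·℘_{Λ_W}(E_f)·B_d·Δ^a` (STATUS 2026-08-30T00:06Z).  For a modular parametrisation datum `D` of `W` (Manin constant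
`c ≠ 0`, Néron pair `D.L`, `cΛ_f ⊆ Λ_W`) write `L′ := c⁻¹·D.L` (`PeriodPair.mulLeft`), so `Λ_f ⊆ Λ(L′) ⊇ Λ_W`.

* `periodLattice_le_mulLeft_inv`, `lattice_le_mulLeft_inv`, `exists_rat_g₂_mulLeft_inv`, `exists_rat_g₃_mulLeft_inv` —
  `Λ_f ⊆ c⁻¹Λ_W ⊇ Λ_W`, `g₂(c⁻¹Λ_W) = c⁴c₄(W)/12 ∈ ℚ`, `g₃(c⁻¹Λ_W) = c⁶c₆(W)/216 ∈ ℚ`.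
* **N1** `exists_int_isXPresentation` — there are `k ≥ 12` and cusp forms `F, G ∈ S_k(Γ₀(N))`, `G` with INTEGER Fourier
  coefficients, presenting `x′ = ℘_{c⁻¹Λ_W}(E_f)` (`IsXPresentation D.f L′ F G`): the tree's rational presentation
  (`X1RatPres.exists_rat_isXPresentation`, Shimura 3.52 descent) scaled by its denominator.
* **N2** `meromorphicOrderAt_weierstrassP_mul_nonneg` — if `(F, G)` presents `℘_{L′}(E_f)` and `Λ(L) ⊆ Λ(L′)`, then at every
  pole `z` of `℘_L(E_f)` (`E_f(z) ∈ Λ(L)`) the product `℘_L(E_f)·G` has non-negative meromorphic order: both `℘_L(E_f)` and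
  `℘_{L′}(E_f)` have order `−2·ord_z(E_f − E_f(z))` there (`meromorphicOrderAt_weierstrassP_eichlerIntegral`), and
  `℘_{L′}(E_f)·G = F` on a punctured neighbourhood (`eventually_nhdsNE_eichlerIntegral_notMem`).
* **N3** `exists_invariant_extension_of_cuspSymbol_mem` — the tree's `exists_invariant_extension` with the hypothesis
  `Λ_f ⊆ Λ` REMOVED: for `G` holomorphic with `G(γτ) = (cτ+d)^K G(τ)` (`γ ∈ Γ₀(N)`) killing the poles of `℘_Λ(E_f)`, the
  normal form `F` of `℘_Λ(E_f)·G` is holomorphic on `ℍ`, equals `℘_Λ(E_f)G` off the poles, and `F ∣[K] γ = F` for every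
  `γ ∈ Γ₀(N)` whose cusp symbol `{∞, γ∞}_f` lies in `Λ` (the stabiliser `Γ^{(c)}` when `Λ = Λ_W`).
* **N5** `cuspSymbol_mem_of_slash_eq` — conversely, if such an `F` satisfies `F ∣[K] γ = F` for some `γ ∈ Γ₀(N)` and `G ≢ 0`,
  then `{∞, γ∞}_f ∈ Λ` (Manin's lemma `PeriodPair.mem_lattice_of_weierstrassP_comp_add_eventuallyEq`).

Everything is proved (standard axioms); no named fact.  BSD is not proved by this file; C2/C3 are not proved by this file.
-/

set_option linter.dupNamespace false
set_option autoImplicit false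

noncomputable section

open Complex Filter Topology Set Function
open UpperHalfPlane hiding I
open scoped Real Topology Manifold MatrixGroups PeriodPair ModularForm
open ModularForm SlashInvariantForm ModularFormClass CongruenceSubgroup

open Literature.NumberTheory.EllipticCurves Literature.NumberTheory.EllipticCurves.ModularForms

namespace Summit.BirchSwinnertonDyer.BirchSwinnertonDyer.Theorems.ManinLocalTwoThree.CDivision

variable {N : ℕ} [NeZero N]

/-! ### The pair `L′ = c⁻¹·Λ_W` -/

/-- `Λ_f ⊆ c⁻¹Λ_W` (from `cΛ_f ⊆ Λ_W`). [folklore] -/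
theorem periodLattice_le_mulLeft_inv {W : WeierstrassCurve ℚ} (D : ModularParametrizationData W N)
    (hc : (D.c : ℂ) ≠ 0) :
    ∀ x ∈ periodLattice D.f, x ∈ (D.L.mulLeft ((D.c : ℂ)⁻¹) (inv_ne_zero hc)).lattice := by
  intro x hx
  rw [PeriodPair.mem_mulLeft_lattice, inv_inv]
  exact D.smul_periodLattice_le x hx

/-- `Λ_W ⊆ c⁻¹Λ_W` (`c ∈ ℤ`). [folklore] -/
theorem lattice_le_mulLeft_inv {W : WeierstrassCurve ℚ} (D : ModularParametrizationData W N)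
    (hc : (D.c : ℂ) ≠ 0) :
    ∀ z ∈ D.L.lattice, z ∈ (D.L.mulLeft ((D.c : ℂ)⁻¹) (inv_ne_zero hc)).lattice := by
  intro z hz
  rw [PeriodPair.mem_mulLeft_lattice, inv_inv]
  simpa [zsmul_eq_mul] using zsmul_mem hz D.c

/-- `g₂(c⁻¹Λ_W) = c⁴·c₄(W)/12 ∈ ℚ`. [folklore] -/
theorem exists_rat_g₂_mulLeft_inv {W : WeierstrassCurve ℚ} (D : ModularParametrizationData W N)
    (hc : (D.c : ℂ) ≠ 0) :
    ∃ q : ℚ, (q : ℂ) = (D.L.mulLeft ((D.c : ℂ)⁻¹) (inv_ne_zero hc)).g₂ := by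
  refine ⟨(D.c : ℚ) ^ 4 * (W.c₄ / 12), ?_⟩
  rw [PeriodPair.g₂_mulLeft, D.isNeronLattice.1, inv_pow, inv_inv]
  simp only [WeierstrassCurve.baseChange, WeierstrassCurve.map_c₄, eq_ratCast]
  push_cast
  ring

/-- `g₃(c⁻¹Λ_W) = c⁶·c₆(W)/216 ∈ ℚ`. [folklore] -/
theorem exists_rat_g₃_mulLeft_inv {W : WeierstrassCurve ℚ} (D : ModularParametrizationData W N)
    (hc : (D.c : ℂ) ≠ 0) :
    ∃ q : ℚ, (q : ℂ) = (D.L.mulLeft ((D.c : ℂ)⁻¹) (inv_ne_zero hc)).g₃ := by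
  refine ⟨(D.c : ℚ) ^ 6 * (W.c₆ / 216), ?_⟩
  rw [PeriodPair.g₃_mulLeft, D.isNeronLattice.2, inv_pow, inv_inv]
  simp only [WeierstrassCurve.baseChange, WeierstrassCurve.map_c₆, eq_ratCast]
  push_cast
  ring

/-! ### N1: an integer presentation of `x′ = ℘_{c⁻¹Λ_W}(E_f)` -/

omit [NeZero N] in
/-- Scaling a presentation by a nonzero constant. [folklore] -/
theorem isXPresentation_smul {k : ℤ} {f : CuspForm (Gamma0 N) 2} {L : PeriodPair} {F G : CuspForm (Gamma0 N) k}
    (h : IsXPresentation f L F G) {a : ℂ} (ha : a ≠ 0) : IsXPresentation f L (a • F) (a • G) := by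
  refine ⟨fun h0 ↦ h.1 ?_, fun τ hτ ↦ ?_⟩
  · have := congrArg (fun H : CuspForm (Gamma0 N) k ↦ a⁻¹ • H) h0
    simpa [smul_smul, inv_mul_cancel₀ ha] using this
  · have := h.2 τ hτ
    simp only [CuspForm.IsGLPos.coe_smul, Pi.smul_apply, smul_eq_mul]
    rw [← this]
    ring

/-- **N1 (integer `x`-presentation of the `c`-division coordinate).**  There are `k ≥ 12` and cusp forms
`F, G ∈ S_k(Γ₀(N))` with `IsXPresentation D.f (c⁻¹·D.L) F G` (`G ≠ 0`, `℘_{c⁻¹Λ_W}(E_f(τ))·G(τ) = F(τ)` off the poles)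
and `aₘ(G) ∈ ℤ` for all `m`. [cite: ShimuraIATAF1971, Thm. 3.52 and Thm. 7.14] -/
theorem exists_int_isXPresentation {W : WeierstrassCurve ℚ} (D : ModularParametrizationData W N)
    (hc : (D.c : ℂ) ≠ 0) :
    ∃ (k : ℤ) (F G : CuspForm (Gamma0 N) k), 12 ≤ k ∧
      IsXPresentation D.f (D.L.mulLeft ((D.c : ℂ)⁻¹) (inv_ne_zero hc)) F G ∧
      ∀ m, ∃ z : ℤ, cuspCoeff G m = z := by
  have hf : D.f ≠ 0 := D.isNewformOf.1.ne_zero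
  have hrat : ∀ m, ∃ q : ℚ, (q : ℂ) = cuspCoeff D.f m := fun m ↦
    ⟨W.LFunction m, by rw [D.isNewformOf.2 m]; push_cast; rfl⟩
  obtain ⟨k, F, G, Dn, hk, hX, hDn, hDint⟩ :=
    DepletionAtTwo.X1RatPres.exists_rat_isXPresentation D.f hf hrat _ (periodLattice_le_mulLeft_inv D hc)
      (exists_rat_g₂_mulLeft_inv D hc) (exists_rat_g₃_mulLeft_inv D hc)
  have hDn0 : (Dn : ℂ) ≠ 0 := by exact_mod_cast hDn.ne'
  refine ⟨k, (Dn : ℂ) • F, (Dn : ℂ) • G, hk, isXPresentation_smul hX hDn0, fun m ↦ ?_⟩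
  obtain ⟨z, hz⟩ := hDint m
  exact ⟨z, by rw [cuspCoeff_smul, hz]⟩

/-! ### N2: the denominator kills the poles of `℘_Λ(E_f)` for every `Λ ⊆ Λ(L′)` -/

/-- Off a pole, punctured: for `f ≠ 0` and `Im z > 0`, on a punctured neighbourhood of `z` the Eichler integral avoids
the lattice (its lattice values are isolated: `u` is non-constant analytic and `Λ` is discrete). [folklore] -/
theorem eventually_nhdsNE_eichlerIntegral_notMem (f : CuspForm (Gamma0 N) 2) (hf : f ≠ 0) (L : PeriodPair) {z : ℂ}
    (hz : 0 < z.im) :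
    ∀ᶠ w in 𝓝[≠] z, 0 < w.im ∧ eichlerIntegral f (ofComplex w) ∉ L.lattice := by
  set U : ℂ → ℂ := fun w ↦ eichlerIntegral f (ofComplex w) with hU
  have han : AnalyticAt ℂ U z := analyticAt_eichlerIntegral_comp_ofComplex f hz
  have h0 : ∀ᶠ w in 𝓝 z, 0 < w.im := isOpen_upperHalfPlaneSet.mem_nhds hz
  have h1 : ∀ᶠ w in 𝓝 z, U w ∈ ((L.lattice : Set ℂ) \ {U z})ᶜ :=
    han.continuousAt.preimage_mem_nhds (L.compl_lattice_sdiff_singleton_mem_nhds (U z))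
  have h2 : ∀ᶠ w in 𝓝[≠] z, U w ≠ U z := by
    have han' : AnalyticAt ℂ (fun w ↦ U w - U z) z := han.sub analyticAt_const
    rcases han'.eventually_eq_zero_or_eventually_ne_zero with h | h
    · exfalso
      apply not_eventually_const_eichlerIntegral f hf hz (U z)
      filter_upwards [h] with w hw
      simpa [sub_eq_zero] using hw
    · filter_upwards [h] with w hw
      simpa [sub_eq_zero] using hw
  filter_upwards [h2, nhdsWithin_le_nhds h1, nhdsWithin_le_nhds h0] with w hw2 hw1 hw0
  exact ⟨hw0, fun hw ↦ hw1 ⟨hw, hw2⟩⟩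

/-- **N2 (pole killing).**  Let `(F, G)` present `℘_{L′}(E_f)` and `Λ(L) ⊆ Λ(L′)`.  At a pole `z` of `℘_L(E_f)` the product
`℘_L(E_f)·G` has non-negative order: `ord_z ℘_L(E_f) = ord_z ℘_{L′}(E_f) = −2·ord_z(E_f − E_f(z))`, so
`ord_z(℘_L(E_f)·G) = ord_z(℘_{L′}(E_f)·G) = ord_z F ≥ 0`. [folklore] -/
theorem meromorphicOrderAt_weierstrassP_mul_nonneg {k : ℤ} (f : CuspForm (Gamma0 N) 2) (hf : f ≠ 0)
    {L L' : PeriodPair} {F G : CuspForm (Gamma0 N) k} (hX : IsXPresentation f L' F G)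
    (hLL' : ∀ z ∈ L.lattice, z ∈ L'.lattice) {z : ℂ} (hz : 0 < z.im)
    (hzL : eichlerIntegral f (ofComplex z) ∈ L.lattice) :
    0 ≤ meromorphicOrderAt ((fun w : ℂ ↦ ℘[L] (eichlerIntegral f (ofComplex w))) * (⇑G ∘ ofComplex)) z := by
  have hzL' : eichlerIntegral f (ofComplex z) ∈ L'.lattice := hLL' _ hzL
  have hordL := meromorphicOrderAt_weierstrassP_eichlerIntegral f hf L hz hzL
  have hordL' := meromorphicOrderAt_weierstrassP_eichlerIntegral f hf L' hz hzL'
  have hGan : AnalyticAt ℂ (⇑G ∘ ofComplex) z :=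
    (UpperHalfPlane.mdifferentiable_iff.mp G.holo').analyticAt (isOpen_upperHalfPlaneSet.mem_nhds hz)
  have hFan : AnalyticAt ℂ (⇑F ∘ ofComplex) z :=
    (UpperHalfPlane.mdifferentiable_iff.mp F.holo').analyticAt (isOpen_upperHalfPlaneSet.mem_nhds hz)
  have hXm : MeromorphicAt (fun w : ℂ ↦ ℘[L] (eichlerIntegral f (ofComplex w))) z :=
    meromorphicAt_weierstrassP_eichlerIntegral f L hz
  have hXm' : MeromorphicAt (fun w : ℂ ↦ ℘[L'] (eichlerIntegral f (ofComplex w))) z :=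
    meromorphicAt_weierstrassP_eichlerIntegral f L' hz
  rw [meromorphicOrderAt_mul hXm hGan.meromorphicAt, hordL, ← hordL', ← meromorphicOrderAt_mul hXm' hGan.meromorphicAt]
  have hev : ((fun w : ℂ ↦ ℘[L'] (eichlerIntegral f (ofComplex w))) * (⇑G ∘ ofComplex)) =ᶠ[𝓝[≠] z]
      (⇑F ∘ ofComplex) := by
    filter_upwards [eventually_nhdsNE_eichlerIntegral_notMem f hf L' hz] with w hw
    simp only [Pi.mul_apply, comp_apply]
    exact hX.2 (ofComplex w) hw.2
  rw [meromorphicOrderAt_congr hev]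
  exact hFan.meromorphicOrderAt_nonneg

/-- N2 for the datum: the integer denominator `G` of N1 kills the poles of `℘_{Λ_W}(E_f)` (`Λ_W ⊆ c⁻¹Λ_W`). [folklore] -/
theorem meromorphicOrderAt_weierstrassP_mul_nonneg_datum {W : WeierstrassCurve ℚ} (D : ModularParametrizationData W N)
    (hc : (D.c : ℂ) ≠ 0) {k : ℤ} {F G : CuspForm (Gamma0 N) k}
    (hX : IsXPresentation D.f (D.L.mulLeft ((D.c : ℂ)⁻¹) (inv_ne_zero hc)) F G) {z : ℂ} (hz : 0 < z.im)
    (hzL : eichlerIntegral D.f (ofComplex z) ∈ D.L.lattice) :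
    0 ≤ meromorphicOrderAt ((fun w : ℂ ↦ ℘[D.L] (eichlerIntegral D.f (ofComplex w))) * (⇑G ∘ ofComplex)) z :=
  meromorphicOrderAt_weierstrassP_mul_nonneg D.f D.isNewformOf.1.ne_zero hX (lattice_le_mulLeft_inv D hc) hz hzL

/-! ### N3: the holomorphic extension, invariant under the stabiliser `{γ : {∞, γ∞}_f ∈ Λ}` -/

/-- `E_f(γτ) = E_f(τ) + {∞, γ∞}_f`. [folklore] -/
theorem eichlerIntegral_gamma_smul_eq_add (f : CuspForm (Gamma0 N) 2) (γ : Gamma0 N) (τ : ℍ) :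
    eichlerIntegral f ((γ : SL(2, ℤ)) • τ) = eichlerIntegral f τ + cuspSymbol f γ := by
  have h := eichlerIntegral_smul_sub_holds f γ τ
  rw [← h]; ring

/-- For `{∞, γ∞}_f ∈ Λ`: `E_f(γτ) ∈ Λ ↔ E_f(τ) ∈ Λ`. [folklore] -/
theorem eichlerIntegral_gamma_smul_mem_iff_of_cuspSymbol_mem (f : CuspForm (Gamma0 N) 2) (L : PeriodPair)
    (γ : Gamma0 N) (hγ : cuspSymbol f γ ∈ L.lattice) (τ : ℍ) :
    eichlerIntegral f ((γ : SL(2, ℤ)) • τ) ∈ L.lattice ↔ eichlerIntegral f τ ∈ L.lattice := by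
  rw [eichlerIntegral_gamma_smul_eq_add]
  constructor
  · intro h
    simpa using sub_mem h hγ
  · intro h
    exact add_mem h hγ

/-- For `{∞, γ∞}_f ∈ Λ`: `℘_Λ(E_f(γτ)) = ℘_Λ(E_f(τ))`. [folklore] -/
theorem weierstrassP_eichlerIntegral_gamma_smul_of_cuspSymbol_mem (f : CuspForm (Gamma0 N) 2) (L : PeriodPair)
    (γ : Gamma0 N) (hγ : cuspSymbol f γ ∈ L.lattice) (τ : ℍ) :
    ℘[L] (eichlerIntegral f ((γ : SL(2, ℤ)) • τ)) = ℘[L] (eichlerIntegral f τ) := by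
  rw [eichlerIntegral_gamma_smul_eq_add]
  exact L.weierstrassP_add_coe (eichlerIntegral f τ) ⟨_, hγ⟩

/-- **N3 (removable singularities and invariance under the stabiliser).**  Let `f ≠ 0`, `Λ` ANY period pair, and
`G : ℍ → ℂ` holomorphic with `G(γτ) = (cτ + d)^K G(τ)` for `γ ∈ Γ₀(N)`, such that at every pole `w` of `X = ℘_Λ ∘ E_f`
the product `X·(G ∘ ofComplex)` has non-negative order.  Then there is a holomorphic `F : ℍ → ℂ` with
`F(τ) = ℘_Λ(E_f(τ))G(τ)` off the poles and `F ∣[K] γ = F` for every `γ ∈ Γ₀(N)` with `{∞, γ∞}_f ∈ Λ` (the tree's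
`exists_invariant_extension` without the hypothesis `Λ_f ⊆ Λ`: `F` is the meromorphic normal form of `X·G`; the
invariance holds off the countable pole set, where `X(γτ) = X(τ)` by `{∞, γ∞}_f ∈ Λ`, hence everywhere by the identity
theorem). [folklore] -/
theorem exists_invariant_extension_of_cuspSymbol_mem (f : CuspForm (Gamma0 N) 2) (hf : f ≠ 0) (L : PeriodPair)
    (G : ℍ → ℂ) (K : ℕ) (hGan : AnalyticOnNhd ℂ (G ∘ ofComplex) {z : ℂ | 0 < z.im})
    (hGsmul : ∀ (γ : SL(2, ℤ)), γ ∈ Gamma0 N → ∀ τ : ℍ, G (γ • τ) = denom γ τ ^ K * G τ)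
    (hkill : ∀ z : ℂ, 0 < z.im → eichlerIntegral f (ofComplex z) ∈ L.lattice →
      0 ≤ meromorphicOrderAt ((fun w : ℂ ↦ ℘[L] (eichlerIntegral f (ofComplex w))) *
        (G ∘ ofComplex)) z) :
    ∃ F : ℍ → ℂ, MDifferentiable 𝓘(ℂ) 𝓘(ℂ) F ∧
      (∀ γ : Gamma0 N, cuspSymbol f γ ∈ L.lattice → F ∣[(K : ℤ)] (γ : SL(2, ℤ)) = F) ∧
      ∀ τ : ℍ, eichlerIntegral f τ ∉ L.lattice → ℘[L] (eichlerIntegral f τ) * G τ = F τ := by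
  set U : ℂ → ℂ := fun w ↦ eichlerIntegral f (ofComplex w) with hU
  set X : ℂ → ℂ := fun w ↦ ℘[L] (eichlerIntegral f (ofComplex w)) with hX
  set Gc : ℂ → ℂ := G ∘ ofComplex with hGc
  set H : Set ℂ := {z : ℂ | 0 < z.im} with hH
  -- `X·Gc` is meromorphic on the half-plane with non-negative orders
  have hXm : ∀ z ∈ H, MeromorphicAt X z := fun z hz ↦
    meromorphicAt_weierstrassP_eichlerIntegral f L hz
  have hXG : MeromorphicOn (X * Gc) H := fun z hz ↦ (hXm z hz).mul (hGan z hz).meromorphicAt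
  have hXan : ∀ z ∈ H, U z ∉ L.lattice → AnalyticAt ℂ X z := fun z hz hzL ↦
    analyticOnNhd_weierstrassP_eichlerIntegral f L z ⟨hz, hzL⟩
  have hord : ∀ z ∈ H, 0 ≤ meromorphicOrderAt (X * Gc) z := by
    intro z hz
    by_cases hzL : U z ∈ L.lattice
    · exact hkill z hz hzL
    · exact meromorphicOrderAt_mul_nonneg_of_analyticAt (hXan z hz hzL) (hGan z hz)
  -- the normal form `Fc`
  set Fc : ℂ → ℂ := toMeromorphicNFOn (X * Gc) H with hFc
  have hFan : AnalyticOnNhd ℂ Fc H := fun z hz ↦ analyticAt_toMeromorphicNFOn hXG hz (hord z hz)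
  have hFeq : ∀ z ∈ H, U z ∉ L.lattice → Fc z = X z * Gc z := fun z hz hzL ↦
    toMeromorphicNFOn_apply_of_analyticAt hXG hz ((hXan z hz hzL).mul (hGan z hz))
  -- invariance of `Fc` on the half-plane under the stabiliser
  have hinv : ∀ γ : Gamma0 N, cuspSymbol f γ ∈ L.lattice → ∀ z ∈ H,
      Fc (moebius (γ : SL(2, ℤ)) z) =
        ((((γ : SL(2, ℤ)) 1 0 : ℤ) : ℂ) * z + (((γ : SL(2, ℤ)) 1 1 : ℤ) : ℂ)) ^ K * Fc z := by
    intro γ hγ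
    -- both sides are analytic on `H`
    have hA : AnalyticOnNhd ℂ (Fc ∘ moebius (γ : SL(2, ℤ))) H := fun z hz ↦
      (hFan (moebius (γ : SL(2, ℤ)) z) (moebius_im_pos (γ : SL(2, ℤ)) hz)).comp
        (analyticAt_moebius (γ : SL(2, ℤ)) hz)
    have hB : AnalyticOnNhd ℂ (fun z ↦ ((((γ : SL(2, ℤ)) 1 0 : ℤ) : ℂ) * z +
        (((γ : SL(2, ℤ)) 1 1 : ℤ) : ℂ)) ^ K * Fc z) H :=
      fun z hz ↦ (((analyticAt_const.mul analyticAt_id).add analyticAt_const).pow K).mul (hFan z hz)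
    -- they agree off the poles
    have hagree : ∀ z ∈ H, U z ∉ L.lattice →
        (Fc ∘ moebius (γ : SL(2, ℤ))) z =
          ((((γ : SL(2, ℤ)) 1 0 : ℤ) : ℂ) * z + (((γ : SL(2, ℤ)) 1 1 : ℤ) : ℂ)) ^ K * Fc z := by
      intro z hz hzL
      have hz' : 0 < (moebius (γ : SL(2, ℤ)) z).im := moebius_im_pos (γ : SL(2, ℤ)) hz
      have hzL' : U (moebius (γ : SL(2, ℤ)) z) ∉ L.lattice := by
        simp only [hU]
        rw [← smul_ofComplex (γ : SL(2, ℤ)) hz]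
        exact fun h ↦ hzL ((eichlerIntegral_gamma_smul_mem_iff_of_cuspSymbol_mem f L γ hγ (ofComplex z)).mp h)
      rw [comp_apply, hFeq _ hz' hzL', hFeq z hz hzL]
      have hXeq : X (moebius (γ : SL(2, ℤ)) z) = X z := by
        simp only [hX]
        rw [← smul_ofComplex (γ : SL(2, ℤ)) hz]
        exact weierstrassP_eichlerIntegral_gamma_smul_of_cuspSymbol_mem f L γ hγ (ofComplex z)
      have hGeq : Gc (moebius (γ : SL(2, ℤ)) z) =
          ((((γ : SL(2, ℤ)) 1 0 : ℤ) : ℂ) * z + (((γ : SL(2, ℤ)) 1 1 : ℤ) : ℂ)) ^ K * Gc z := by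
        simp only [hGc, comp_apply]
        rw [← smul_ofComplex (γ : SL(2, ℤ)) hz, hGsmul (γ : SL(2, ℤ)) γ.2 (ofComplex z),
          denom_ofComplex (γ : SL(2, ℤ)) hz]
      rw [hXeq, hGeq]
      ring
    -- identity theorem
    obtain ⟨z₀, hz₀⟩ := nonempty_diff_of_countable (countable_setOf_eichlerIntegral_mem_lattice f L hf)
    have hz₀H : z₀ ∈ H := hz₀.1
    have hz₀L : U z₀ ∉ L.lattice := fun h ↦ hz₀.2 ⟨hz₀.1, h⟩
    have hev : (Fc ∘ moebius (γ : SL(2, ℤ))) =ᶠ[𝓝 z₀] fun z ↦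
        ((((γ : SL(2, ℤ)) 1 0 : ℤ) : ℂ) * z + (((γ : SL(2, ℤ)) 1 1 : ℤ) : ℂ)) ^ K * Fc z := by
      filter_upwards [(isOpen_setOf_eichlerIntegral_notMem_lattice f L).mem_nhds ⟨hz₀H, hz₀L⟩]
        with z hz
      exact hagree z hz.1 hz.2
    have heq := hA.eqOn_of_preconnected_of_eventuallyEq hB convex_setOf_im_pos.isPreconnected
      hz₀H hev
    intro z hz
    exact heq hz
  -- the function on `ℍ`
  refine ⟨fun τ : ℍ ↦ Fc τ, ?_, ?_, ?_⟩
  · rw [UpperHalfPlane.mdifferentiable_iff]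
    refine hFan.differentiableOn.congr fun z hz ↦ ?_
    simp only [comp_apply, ofComplex_apply_of_im_pos hz, UpperHalfPlane.coe_mk]
  · intro γ hγ
    funext τ
    have hd : denom (γ : SL(2, ℤ)) τ =
        (((γ : SL(2, ℤ)) 1 0 : ℤ) : ℂ) * (τ : ℂ) + (((γ : SL(2, ℤ)) 1 1 : ℤ) : ℂ) := by
      rw [← denom_ofComplex (γ : SL(2, ℤ)) τ.im_pos, ofComplex_apply]
    have hd0 : denom (γ : SL(2, ℤ)) τ ≠ 0 := denom_ne_zero (γ : SL(2, ℤ)) τ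
    have h1 : ((((γ : SL(2, ℤ)) • τ : ℍ)) : ℂ) = moebius (γ : SL(2, ℤ)) τ := by
      rw [← coe_smul_ofComplex (γ : SL(2, ℤ)) τ.im_pos, ofComplex_apply]
    rw [ModularForm.SL_slash_apply]
    show Fc ((((γ : SL(2, ℤ)) • τ : ℍ)) : ℂ) * denom (γ : SL(2, ℤ)) τ ^ (-(K : ℤ)) = Fc τ
    rw [h1, hinv γ hγ τ τ.im_pos, ← hd, zpow_neg, zpow_natCast, mul_comm (denom (γ : SL(2, ℤ)) τ ^ K) _,
      mul_assoc, mul_inv_cancel₀ (pow_ne_zero _ hd0), mul_one]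
  · intro τ hτ
    show ℘[L] (eichlerIntegral f τ) * G τ = Fc τ
    have := hFeq τ τ.im_pos (by simpa [hU, ofComplex_apply] using hτ)
    rw [this]
    simp [hX, hGc, ofComplex_apply]

/-! ### N5: the stabiliser is exactly `{γ : {∞, γ∞}_f ∈ Λ}` -/

/-- **N5 (exact stabiliser, Manin's lemma).**  Let `f ≠ 0`, `G : ℍ → ℂ` holomorphic, not identically zero, with
`G(γτ) = (cτ + d)^K G(τ)` for ONE `γ ∈ Γ₀(N)`, and `F(τ) = ℘_Λ(E_f(τ))G(τ)` off the poles.  If `F ∣[K] γ = F` then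
`{∞, γ∞}_f ∈ Λ`: off the poles and the zeros of `G`, `℘_Λ(E_f(τ) + {∞,γ∞}) = ℘_Λ(E_f(τ))`, and a local translation
symmetry of `℘_Λ ∘ E_f` (`E_f` non-constant) is a period (`PeriodPair.mem_lattice_of_weierstrassP_comp_add_eventuallyEq`).
[cite: Manin1972, Prop. 1.4] -/
theorem cuspSymbol_mem_of_slash_eq (f : CuspForm (Gamma0 N) 2) (hf : f ≠ 0) (L : PeriodPair) (G F : ℍ → ℂ) (K : ℕ)
    (hGmd : MDifferentiable 𝓘(ℂ) 𝓘(ℂ) G) (hG1 : ∃ τ₁ : ℍ, G τ₁ ≠ 0) (γ : Gamma0 N)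
    (hGsmul : ∀ τ : ℍ, G ((γ : SL(2, ℤ)) • τ) = denom (γ : SL(2, ℤ)) τ ^ K * G τ)
    (hFG : ∀ τ : ℍ, eichlerIntegral f τ ∉ L.lattice → ℘[L] (eichlerIntegral f τ) * G τ = F τ)
    (hγ : F ∣[(K : ℤ)] (γ : SL(2, ℤ)) = F) : cuspSymbol f γ ∈ L.lattice := by
  set s : ℂ := cuspSymbol f γ with hs
  set U : ℂ → ℂ := fun w ↦ eichlerIntegral f (ofComplex w) with hU
  set Gc : ℂ → ℂ := G ∘ ofComplex with hGc
  set H : Set ℂ := {z : ℂ | 0 < z.im} with hH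
  have hUc : ContinuousOn U H := (differentiableOn_eichlerIntegral_comp_ofComplex f).continuousOn
  have hGc' : ContinuousOn Gc H := (UpperHalfPlane.mdifferentiable_iff.mp hGmd).continuousOn
  -- the pointwise identity off poles and zeros of `G`
  have hpt : ∀ τ : ℍ, eichlerIntegral f τ ∉ L.lattice → s + eichlerIntegral f τ ∉ L.lattice → G τ ≠ 0 →
      ℘[L] (s + eichlerIntegral f τ) = ℘[L] (eichlerIntegral f τ) := by
    intro τ h1 h2 hG
    have h := congr_fun hγ τ
    rw [ModularForm.SL_slash_apply] at h
    have h2' : eichlerIntegral f ((γ : SL(2, ℤ)) • τ) ∉ L.lattice := by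
      rw [eichlerIntegral_gamma_smul_eq_add, add_comm]; exact h2
    rw [← hFG _ h2', ← hFG _ h1, hGsmul τ, eichlerIntegral_gamma_smul_eq_add, add_comm _ s] at h
    have hd0 : denom (γ : SL(2, ℤ)) τ ≠ 0 := denom_ne_zero (γ : SL(2, ℤ)) τ
    have h' : ℘[L] (s + eichlerIntegral f τ) * G τ = ℘[L] (eichlerIntegral f τ) * G τ := by
      have : ℘[L] (s + eichlerIntegral f τ) * (denom (γ : SL(2, ℤ)) τ ^ K * G τ) *
          denom (γ : SL(2, ℤ)) τ ^ (-(K : ℤ)) = ℘[L] (s + eichlerIntegral f τ) * G τ := by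
        rw [zpow_neg, zpow_natCast]; field_simp
      rw [← this, h]
    exact mul_right_cancel₀ hG h'
  -- a good point: `G ≠ 0`, `U ∉ Λ`, `s + U ∉ Λ`
  set O : Set ℂ := {z : ℂ | 0 < z.im ∧ (Gc z ≠ 0 ∧ s + U z ∉ L.lattice)} with hO
  have hOopen : IsOpen O := by
    have h1 : IsOpen {z : ℂ | 0 < z.im ∧ Gc z ∈ ({0} : Set ℂ)ᶜ} :=
      hGc'.isOpen_inter_preimage isOpen_upperHalfPlaneSet isOpen_compl_singleton
    have h2 : IsOpen {z : ℂ | 0 < z.im ∧ s + U z ∈ (L.lattice : Set ℂ)ᶜ} :=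
      (continuousOn_const.add hUc).isOpen_inter_preimage isOpen_upperHalfPlaneSet L.isClosed_lattice.isOpen_compl
    have : O = {z : ℂ | 0 < z.im ∧ Gc z ∈ ({0} : Set ℂ)ᶜ} ∩ {z : ℂ | 0 < z.im ∧ s + U z ∈ (L.lattice : Set ℂ)ᶜ} := by
      ext z
      simp only [hO, mem_setOf_eq, mem_inter_iff, mem_compl_iff, mem_singleton_iff, SetLike.mem_coe]
      tauto
    rw [this]
    exact h1.inter h2
  have hOne : O.Nonempty := by
    obtain ⟨τ₁, hτ₁⟩ := hG1
    by_contra hne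
    rw [not_nonempty_iff_eq_empty] at hne
    have hz₁ : 0 < (τ₁ : ℂ).im := τ₁.im_pos
    have hG₁ : Gc τ₁ ≠ 0 := by simpa [hGc, ofComplex_apply] using hτ₁
    have e1 : ∀ᶠ w in 𝓝 (τ₁ : ℂ), Gc w ≠ 0 :=
      (hGc'.continuousAt (isOpen_upperHalfPlaneSet.mem_nhds hz₁)).eventually_ne hG₁
    have e2 : ∀ᶠ w in 𝓝 (τ₁ : ℂ), s + U w ∈ ((L.lattice : Set ℂ) \ {s + U τ₁})ᶜ :=
      ((continuousOn_const.add hUc).continuousAt (isOpen_upperHalfPlaneSet.mem_nhds hz₁)).preimage_mem_nhds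
        (L.compl_lattice_sdiff_singleton_mem_nhds (s + U τ₁))
    have e0 : ∀ᶠ w in 𝓝 (τ₁ : ℂ), 0 < w.im := isOpen_upperHalfPlaneSet.mem_nhds hz₁
    apply not_eventually_const_eichlerIntegral f hf hz₁ (U τ₁)
    filter_upwards [e0, e1, e2] with w hw0 hw1 hw2
    have hwO : w ∉ O := by rw [hne]; exact Set.notMem_empty w
    have hmem : s + U w ∈ L.lattice := by
      by_contra hnot
      exact hwO ⟨hw0, hw1, hnot⟩
    have : s + U w = s + U τ₁ := by
      by_contra hne'
      exact hw2 ⟨hmem, hne'⟩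
    simpa using this
  obtain ⟨z₀, hz₀O, hz₀T⟩ : (O \ {z : ℂ | 0 < z.im ∧ U z ∈ L.lattice}).Nonempty := by
    by_contra hne
    rw [not_nonempty_iff_eq_empty, sdiff_eq_empty] at hne
    exact not_countable_of_isOpen hOopen hOne ((countable_setOf_eichlerIntegral_mem_lattice f L hf).mono hne)
  have hz₀ : 0 < z₀.im := hz₀O.1
  have hz₀L : U z₀ ∉ L.lattice := fun h ↦ hz₀T ⟨hz₀, h⟩
  -- the identity holds near `z₀`
  have hev : ∀ᶠ z in 𝓝 z₀, ℘[L] (s + U z) = ℘[L] (U z) := by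
    filter_upwards [hOopen.mem_nhds hz₀O,
      (isOpen_setOf_eichlerIntegral_notMem_lattice f L).mem_nhds ⟨hz₀, hz₀L⟩] with z hzO hzL
    have hG : G (ofComplex z) ≠ 0 := by simpa [hGc] using hzO.2.1
    exact hpt (ofComplex z) hzL.2 hzO.2.2 hG
  exact L.mem_lattice_of_weierstrassP_comp_add_eventuallyEq (analyticAt_eichlerIntegral_comp_ofComplex f hz₀)
    (not_eventually_const_eichlerIntegral f hf hz₀ (U z₀)) hz₀L hz₀O.2.2 hev

end Summit.BirchSwinnertonDyer.BirchSwinnertonDyer.Theorems.ManinLocalTwoThree.CDivision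

end
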